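import Mathlib
import HarnessLib
import HarnessLib.Audit
import Summits.Parity.Statement
import Literature.Barriers.Parity.SiegelZeroDichotomy
import HarnessLib.Audit.Status.Attr

/-!
Route: SiegelBandSplit

CLOSED (superseded) 2026-08-30T10:33:09Z by planner-decomp-parity-lens-2-g8-0 — reason: superseded:route-Parity-SiegelSpectrumSplit — superseded by route-Parity-SiegelSpectrumSplit — note: duplicate rendering of G1.1 (census-trib-parity-1 TRIB-PARITY-ROOTDECOMP-1 row 3 merge_into; writer DECISION HOME/STATUS.md l.423 2026-08-30T10:31:12Z; crit-1 ACK l.403): every statement item is SHARED by id with the record route-Parity-SiegelSpectrumSplit (HighBandZeroFree 25906, LowBandZeroFree 25. The file is kept as the record of this route; refuted decls are indexed as negative knowledge (`ledger negatives`).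

# Route SiegelBandSplit — GHL ⟸ special band (Zhang-type zero-free region) ∧ generic band of Siegel
zeros ∧ both parity halves given Q

decomp-parity (D-0178/D-0179) lens-2 node «SiegelBandSplit» (lens «structural dichotomy: special vs
generic», gen 2), sub
GeneralizedHardyLittlewood; it REFINES the GHL-side node of record SiegelSpectrumSplit (lens-5: GHL
⟸ Q ∧ UQ ∧ LQ) at its blocker leaf
Q = «Siegel zeros have bounded quality at large conductors» (= ¬UnboundedSiegelZeros). A putative
real zero β = 1 − 1/(η log D) of a
primitive quadratic L(s,χ_D) is SPECIAL if β > 1 − c₂(log D)^−2024 and GENERIC if 1 − c/log D < β ≤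
1 − c₂(log D)^−2024. It suffices
to show X = H ∧ L ∧ UQ ∧ LQ: H = HighBandZeroFree (the special band is empty: word for word Zhang's
claimed Theorem 2,
Zhang2022.Skeleton.ZeroFreeRegion 2024), L = LowBandZeroFree (the generic band is empty: the
classical region holds down to the polylog
line (log D)^−2025 at all large conductors), UQ/LQ = the lens-5 items UpperGivenBoundedSiegel /
LowerGivenBoundedSiegel verbatim (the
one-sided halves of shift-uniform GHL conditioned on Q). Kernel: Q ⟺ H ∧ L
(boundedQuality_iff_bands, HOME node file, 0 sorry).
Lean: `(∃ c₂ : ℝ, 0 < c₂ ∧ ∀ (D : ℕ) [NeZero D] (χ : DirichletCharacter ℂ D), 3 ≤ D → χ.IsQuadratic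
→ χ.IsPrimitive → ∀ σ : ℝ, 1 - c₂ / Real.log D ^ 2024 < σ → χ.LFunction σ ≠ 0) ∧ (∃ c : ℝ, 0 < c ∧ ∃
D₀ : ℕ, ∀ (D : ℕ) [NeZero D] (χ : DirichletCharacter ℂ D), D₀ ≤ D → χ.IsQuadratic → χ.IsPrimitive →
∀ σ : ℝ, 1 - c / Real.log D < σ → σ ≤ 1 - 1 / Real.log D ^ 2025 → χ.LFunction σ ≠ 0) ∧ ((∃ η₀ : ℝ, ∃
q₀ : ℕ, ∀ (q : ℕ) [NeZero q] (χ : DirichletCharacter ℂ q) (η : ℝ), q₀ ≤ q →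
Literature.Barriers.Parity.IsSiegelZero χ η → η < η₀) → ∀ (d t L : ℕ), 1 ≤ d → 1 ≤ t → ∀ ε : ℝ, 0 <
ε → ∃ N₀ : ℕ, ∀ N : ℕ, N₀ ≤ N → ∀ Ψ : Fin t → Literature.NumberTheory.Sieve.AffLinForm d,
Literature.NumberTheory.Sieve.IsNondegenerateSystem Ψ → Literature.NumberTheory.Sieve.affLinSize Ψ N
≤ L → ∀ K : Set (Fin d → ℝ), Convex ℝ K → K ⊆ Literature.NumberTheory.Sieve.realBox d N →
Literature.NumberTheory.Sieve.vonMangoldtSum Ψ K N - Literature.NumberTheory.Sieve.archFactor Ψ K *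
Literature.NumberTheory.Sieve.singularProduct Ψ ≤ ε * (N : ℝ) ^ d) ∧ ((∃ η₀ : ℝ, ∃ q₀ : ℕ, ∀ (q : ℕ)
[NeZero q] (χ : DirichletCharacter ℂ q) (η : ℝ), q₀ ≤ q → Literature.Barriers.Parity.IsSiegelZero χ
η → η < η₀) → ∀ (d t L : ℕ), 1 ≤ d → 1 ≤ t → ∀ ε : ℝ, 0 < ε → ∃ N₀ : ℕ, ∀ N : ℕ, N₀ ≤ N → ∀ Ψ : Fin
t → Literature.NumberTheory.Sieve.AffLinForm d, Literature.NumberTheory.Sieve.IsNondegenerateSystem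
Ψ → Literature.NumberTheory.Sieve.affLinSize Ψ N ≤ L → ∀ K : Set (Fin d → ℝ), Convex ℝ K → K ⊆
Literature.NumberTheory.Sieve.realBox d N → Literature.NumberTheory.Sieve.archFactor Ψ K *
Literature.NumberTheory.Sieve.singularProduct Ψ - Literature.NumberTheory.Sieve.vonMangoldtSum Ψ K N
≤ ε * (N : ℝ) ^ d)`

## Assembly
From hH and hL obtain Q (bounded quality at conductors q ≥ max(D₀, 3, ⌈e^{1/c₂}⌉), bound η < 1/c +
1): a Siegel zero 1 − 1/(η log q)
of quality η ≥ 1/c + 1 lies right of the classical line 1 − c/log q, hence either in the special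
band (excluded by hH) or — since
c₂(log q)^−2024 ≥ (log q)^−2025 once log q ≥ 1/c₂ — in the generic band (excluded by hL). Then Q
discharges the hypothesis of hUQ and
hLQ, and for given d,t,L,ε the threshold max(N₁,N₂) and `abs_sub_le_iff` give GHL. All four binders
are consumed (`closes` in
glue.lean, ≈ 45 lines, certified by `ledger route check --native`: closes OK, binder_used 4/4; the
same argument is
`boundedQuality_of_bands_at` in the HOME node file for every dial A). The Assembly item below is the
schema's record of the composition (kind assembly; the four cruxes are exactly the binders of
`closes`).

Rationale: WHY THIS LINE. Every GHL decomposition on the bus keeps the Landau–Siegel leaf Q ATOMIC (lens-5 r2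
BoundedSiegelZeroQuality, lens-4 r3
NoUnboundedSiegelZeros = stmt-Parity-24711, writer GA K_LS), while every live Landau–Siegel route of
the summit (PrimeLevelFamEdge,
ZDegreeToeplitzBand, CentralValueFamily*) concludes the registered leaf Zhang2022.Skeleton.Theorem1
(L(1,χ) ≫ (log D)^−2022,
Zhang2022LandauSiegel), and Theorem 1 yields ONLY the special band H (tree theorem2_of_theorem1;
MontgomeryVaughan2007 (11.10):
L(1,χ) ≪ (1 − β₁) log²q gives the +2). The generic band L — «no real zeros between the classical
line c/log D and the polylog line» — is
the exact typed gap between what the live routes deliver and what the node needs, and nobody had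
named it: this route files it as a
refutable, Q-necessary crux with the kernel certificate that nothing else is missing (Q ⟺ H ∧ L, any
dial A ≥ 1). Imported area:
multiplicative number theory of exceptional characters (DavenportMNT1980 Ch. 14,
MontgomeryVaughan2007 §11.2, TaoTeravainen2021 Def. 1.4,
MatomakiMerikoski2023 for necessity). Versus the negatives index (5 refuted statements, none on real
zeros of quadratic L-functions):
disjoint. Versus the g0 node ExceptionalScaleDichotomy (same lens): the critic's R1 (fix ONE dial: A
= 2024, the unique exponent with a
manuscript claiming H) and R2 (no inert BH conjunct) are met, and the dial now cuts the leaf Q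
itself rather than the scale axis.

RANKED CRUXES. #2 LowBandZeroFree (crux) — piece L «the generic band is empty»: there are c > 0 and
D₀ such that for every primitive quadratic character χ mod D ≥ D₀ and every real σ with 1 − c/log D
< σ ≤ 1 − (log D)^−2025, L(σ,χ) ≠ 0 — the classical zero-free region for real zeros holds DOWN TO
the polylog line (moderate-quality Siegel zeros do not exist). TAG WEAKER: Q ⟹ L in kernel
(lowBandZeroFree_of_boundedQuality); L ⇏ Q (world «only super-polylog-quality zeros»). LEAF
IDEA-NEEDED + INSTRUMENTABLE; BC5 rung PROVED (bc/LowBandZeroFree_rung.lean, standard axioms): the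
finite truncation 3 ≤ D ≤ 4·10^5 at the admissible constant c = 1/5, from the registered leaf
Literature.NumberTheory.LFunctions.NoExceptionalZeroUpTo_4e5_fifth (kernel theorem
NoExceptionalZeroUpTo_4e5_fifth_holds, 243 107 replayed Lu–Zaman–Zhao certificates); foreseen split
odd/even characters (bc/LowBandZeroFree_birth.lean). [difficulty: open-problem] (why it might fail:
it is the part of the Landau–Siegel problem no manuscript even claims: false iff real zeros of
quality between 1/c and (log D)^2024 recur at arbitrarily large conductors; only Siegel's
ineffective η ≪_ε D^ε and Page's «one per scale» are known.) [TaoTeravainen2021,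
MontgomeryVaughan2007, DavenportMNT1980, arXiv:2602.03626]
#3 HighBandZeroFree (crux) — piece H «the special band is empty»: there is c₂ > 0 such that for
every primitive quadratic χ mod D ≥ 3 and real σ > 1 − c₂(log D)^−2024, L(σ,χ) ≠ 0 — word for word
Zhang's claimed Theorem 2 (= Literature Zhang2022.Skeleton.ZeroFreeRegion 2024 = Skeleton.Theorem2,
Iff.rfl), implied in kernel by the registered leaf F-S3 Skeleton.Theorem1 (theorem2_of_theorem1).
TAG WEAKER: Q ⟹ H in kernel (highBandZeroFree_of_boundedQuality); H ⇏ Q (world «all real zeros have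
quality ≍ √log D»). LEAF ATTACKABLE (live routes PrimeLevelFamEdge / ZDegreeToeplitzBand close
Theorem1; BC3 skeleton = PLFE's six items ⇒ Theorem1 ⇒ H, bc/HighBandZeroFree_birth.lean); BC5 rung
PROVED (bc/HighBandZeroFree_rung.lean): truncation D ≤ 4·10^5 at c₂ = 1/5 from the same leaf.
[difficulty: open-problem] (why it might fail: Zhang2022LandauSiegel Thm 2 is a claim under
adjudication, not refereed; it is false iff real zeros of quality > (log D)^2024/c₂ exist for
infinitely many conductors (no unconditional exclusion beyond Siegel's ineffective bound).)
[Zhang2022LandauSiegel, MontgomeryVaughan2007, DavenportMNT1980]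
#4 UpperGivenBoundedSiegel (crux) — the lens-5 item SiegelSpectrumSplit.UpperGivenBoundedSiegel
VERBATIM (shared by signature): assuming bounded Siegel-zero quality at large conductors, the UPPER
half of shift-uniform GHL — for all d, t, L, ε and N ≥ N₀(d,t,L,ε), every non-degenerate system Ψ
with ‖Ψ‖_N ≤ L and convex K ⊆ [−N,N]^d has Σ_{n∈K} ∏Λ(ψ_i(n)) − β_∞·∏β_p ≤ εN^d. TAG
DECLARED-RESIDUAL(Q), upper parity half; rung ladder 4 (PROVED,
TwinSieveFour.twinSieveUpperBound_four) → 7/2 → 3.29956 → 2 (EH). [difficulty: open-problem] (why it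
might fail: as a TARGET it is the parity-even half of GHL with the Siegel obstruction removed:
uniform upper constants below 2 are blocked for Type-I sieves (Selberg1949) and even factor 1+o(1)
for pairs is open under GRH; it may be as hard as GHL given Q.) [Selberg1949, Bombieri1976,
GreenTao2010, FriedlanderIwaniec2022]
#5 LowerGivenBoundedSiegel (crux) — the lens-5 item SiegelSpectrumSplit.LowerGivenBoundedSiegel
VERBATIM (shared by signature): assuming bounded Siegel-zero quality at large conductors, the LOWER
half of shift-uniform GHL — same quantifier block, conclusion β_∞·∏β_p − Σ ≤ εN^d. TAG
DECLARED-RESIDUAL(Q), lower parity half; LEAF IDEA-NEEDED + BARRIER (prime-pair parity); rung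
TwinLowerDensity (stmt-Parity-18377). [difficulty: open-problem] (why it might fail: as a TARGET it
contains the twin prime asymptotic lower bound; every Type-I/II route to positive pair lower bounds
is blocked by parity (Selberg1949, Bombieri1976, FordMaynard2024) even given Q; no idea on file
produces primes in pairs.) [GreenTao2010, Bombieri1976, FordMaynard2024, FriedlanderIwaniec2022]

TWO-LAYER PLAN. Under H no split: its children are the live routes of the leaf
Zhang2022.Skeleton.Theorem1 (PrimeLevelFamEdge, ZDegreeToeplitzBand;
kernel edge theorem2_of_theorem1; BC3 skeleton bc/HighBandZeroFree_birth.lean = PLFE's six items ⇒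
Theorem1 ⇒ H, rc 0, sorries = 6 stubs).
Under L ONE glued split is foreseen (not filed now), the lens a third time: L ⇐ LowBandOdd →
LowBandEven → L (glue = «a quadratic
character has χ(−1) = ±1», kernel in bc/LowBandZeroFree_birth.lean, rc 0, sorries = 2 stubs): the
ODD child (imaginary quadratic fields,
h(−D) = √D·L(1,χ)/π, no regulator) owns the reduced-forms / CM-heights dictionary —
Goldfeld–Schinzel 1975 «On Siegel's zero»
[galaxy:pdf:3776955900465781500] and Granville–Stark 2000 (uniform abc for number fields ⇒ χ_−D not
exceptional
[corpus:friedlandernd-analytic-number-theory p.87, (3.4)]) — the EVEN child (real quadratic fields,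
regulator) has none (IDEA-NEEDED); the
tree's DHChainInputs already records the same odd/even asymmetry for the Zhang chain.
Rungs/instruments under L: finite certified bands
(leaf NoExceptionalZeroUpTo_4e5_fifth PROVED in kernel; arXiv:2602.03626 q ≤ 10^10 in print;
RealCharacter* NoRealZeroUpTo leaves) and the
dial ladder LowBand A, A < 2024 (lowBand_anti). UQ/LQ as on SiegelSpectrumSplit.

KILL CRITERIA. A proof of UnboundedSiegelZeros refutes H ∧ L (kernel: Q ⟺ H ∧ L) and, by the tree
theorem (mod Matomäki–Merikoski), GHL itself: route and
sub-problem close refuted together. A refutation of H alone (a sequence of real zeros of quality >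
(log D)^2024/c₂ for every c₂) kills Zhang's
claim and this route (close --reason refuted:HighBandZeroFree); the node of record survives with Q
atomic. A refutation of L alone (moderate
zeros recurring) likewise refutes Q and GHL. If Q is proved outright elsewhere, H and L become
theorems and the route degenerates to the
two parity halves (re-file as bare UpperGHL / LowerGHL on the node of record).

NOT DECOMPOSED YET. L is not split further at open: conductor-class splits (prime D, 4 ∣ D,
fundamental discriminants of fixed sign) are all open with no transfer
(Landau–Page repulsion only says «one exceptional conductor per scale», MontgomeryVaughan2007 Cor.
11.10), and a further band split of L at an
intermediate exponent has no claimed or attackable cell today; the dial A is fixed at 2024 (the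
exponent of the only manuscript claiming H)
and is not an item. UQ/LQ are not split (critic rules T2/T3/T8 on the node of record).

CHEAPEST FALSIFIER. (i) That Q really is H ∧ L and not weaker: kernel `boundedQuality_iff_bands`
(HOME/decomp-parity-lens-2/SiegelBandSplit.lean, lean check
rc 0, 0 sorry) — done. (ii) That H is not secretly a theorem or an existing item: `lean search
'ZeroFreeRegion 2024|Theorem2'` finds only the
@[claim] record Zhang2022.Skeleton.Theorem2 and the implication theorem2_of_theorem1 from the open
leaf Theorem1 — no proof; no Theses item
states ZeroFreeRegion 2024. (iii) That L is not vacuous: for D ≥ 3 the band (1 − c/log D, 1 − (log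
D)^−2025] is a non-empty interval for
every c > (log D)^−2024, so the statement quantifies over real σ that exist; it is false in the
world with recurring moderate zeros.

NUMBERS. Dial A = 2024 (Zhang2022LandauSiegel Thm 2: σ > 1 − c₂(log D)^−2024; Thm 1: L(1,χ) > c₁(log
D)^−2022; shift +2 from MontgomeryVaughan2007
(11.10)). Generic-band floor (log D)^−2025 = (log D)^−(A+1). Effective unconditional ceiling: β₁ ≤ 1
− c/(D^{1/2} log²D)
(MontgomeryVaughan2007 Cor. 11.12); Siegel: β₁ ≤ 1 − C(ε)D^−ε ineffective, C(ε) incomputable for ε <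
1/2 (MontgomeryVaughan2007 p. 373).
Certified finite range: no real zero with σ ≥ 1 − 1/(5 log q) for quadratic χ mod q ≤ 10^10
(arXiv:2602.03626 Thm 1.1). Siegel-zero
normal form: quality η ≥ 10, zero at 1 − 1/(η log q) (TaoTeravainen2021 Def. 1.4).

DEFINITION REQUESTS. None: all pieces are stated over existing declarations
(DirichletCharacter.LFunction, IsQuadratic, IsPrimitive, Literature.Barriers.Parity.IsSiegelZero,
AffLinForm, vonMangoldtSum, archFactor, singularProduct, realBox).

Novelty: Searches (2026-08-30): lean search 'ZeroFreeRegion|Theorem2|NoSiegelZeros|UnboundedSiegelZeros'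
(tree: ZeroFreeRegion A defined in Zhang2022/SkeletonSetting with zeroFreeRegion_one_iff,
theorem2_of_theorem1, zeroFreeRegion_of_lOneLowerBound; no item or theorem states a band between
exponents); rg over Summits/Parity/GeneralizedHardyLittlewood/Theses for 'ZeroFreeRegion
2024|Theorem2' (PrimeLevelFamEdge, ZDegreeToeplitzBand, GreenTaoLevelTwo mention Theorem1/Theorem2
only as the leaf); lit search --hybrid "Siegel zero zero-free region log q power effective" (10
docs; relevant: arxiv-2602.03626 pp.1–2); lit vsearch "Siegel zero exceptional real zero …
Deuring–Heilbronn" (montgomery2007 pp.275–287, friedlander Cetraro notes pp.84–86, baker2012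
pp.210–212); lit galaxy search "Landau-Siegel zero|Siegel zero" --star all (25 rows;
pdf:4144984408778879120 Tao–Teräväinen JEMS 2023, panama: Broughan, Pintz–Rassias volume); ledger
negatives --problem Parity (5, none related); bus: all NODE lines (lens-1,4,5,6, GA, g0 lens-2).
Nearest prior art found: Zhang2022LandauSiegel §1 p. 3 (Theorem 1 ⇒ Theorem 2: the special band, and
only it, follows from the claimed L(1,χ) bound); [corpus:montgomery2007 p.281 Cor. 11.10] (Page: at
most one exceptional zero per scale — the special/generic dichotomy at CONDUCTOR level is a theorem)
and [corpus:montgomery2007 p.283 Cor. 11.12] (effective ceiling); [corpus:paper:arxiv-2602.03626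
p.1] (Lu–Zaman–Zhao 2026: certified zero-free region 1 − 1/(5 log q) f  [refs: arxiv-2602.03626, paper:arxiv-2602.03626]

Barriers (technique_class: decomposition, landau-siegel, zero-free-region): - technique_class: decomposition, landau-siegel, zero-free-region
- Literature.Barriers.Parity.BrunTitchmarshSiegelZero: L sits INSIDE for any sieve transfer — a
uniform Brun–Titchmarsh constant 2 − ξ proves all of Q (noSiegelZeros_of_uniformBrunTitchmarsh), so
no upper-bound-sieve improvement can see the band structure; it does not evade it; the bet is that L
is attacked by L-function methods (repulsion / moments / certified numerics), outside the barrier's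
technique class. H: outside (the live routes use mollified discrete means of L-values, not
Brun–Titchmarsh).
- Literature.Barriers.Parity.PrimeLevelTransitionZeroFreeBox: applies to ONE live route under H
(PrimeLevelFamEdge's prime-level dual-side funding line, REV-4), as documented there; it does not
quantify over H as typed (other closers of the leaf Theorem1, e.g. ZDegreeToeplitzBand or Zhang's
own §§3–14, are outside its class).
- Literature.Barriers.Parity.SiegelZeroTwinPrimes: met by design — the exceptional branch
(UnboundedSiegelZeros) refutes H ∧ L and GHL together (kernel Q ⟺ H ∧ L; tree
not_generalizedHardyLittlewood_of_unboundedSiegelZeros); the dichotomy is the necessity argument,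
not an obstacle.
- Literature.Barriers.Parity.SelbergParityBarrier: UQ inside below constant 2 (rungs above 2
attackable), LQ inside for any positive lower bound — declared residuals exactly as on the node of
record; H and L are statements about L-functions, outside every sieve class.
- Literature.Barriers.Parity.PrimePairParity: LQ

History (route lifecycle, newest last):
- 2026-08-30T10:33:09Z · CLOSED superseded — superseded:route-Parity-SiegelSpectrumSplit (planner-decomp-parity-lens-2-g8-0)

sub-problem: GeneralizedHardyLittlewood · status: closed(superseded) · opened planner-decomp-parity-lens-2-g2-0 2026-08-30T03:09:51Z · rev 1 · ledger route-Parity-SiegelBandSplit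
GENERATED by the gate from the ledger (D-0016/17). Provers cite these decls: `theorem foo : Summit.Parity.GeneralizedHardyLittlewood.Theses.SiegelBandSplit.<Decl> := …` in Summits/Parity/GeneralizedHardyLittlewood/Theorems/<Name>.lean.
-/

namespace Summit.Parity.GeneralizedHardyLittlewood.Theses.SiegelBandSplit

open scoped BigOperators Topology Manifold Classical MeasureTheory ProbabilityTheory Matrix InnerProductSpace ComplexConjugate ContinuousMap
open Filter Set Function TopologicalSpace MeasureTheory

attribute [summit_statement] _root_.GeneralizedHardyLittlewood

/-- item stmt-Parity-25907 · crux · rank 2 · open · by planner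
why it might fail: it is the part of the Landau–Siegel problem no manuscript even claims: false iff real zeros of quality between 1/c and (log D)^2024 recur at arbitrarily large conductors; only Siegel's ineffective η ≪_ε D^ε and Page's «one per scale» are known.
sources: TaoTeravainen2021, MontgomeryVaughan2007, DavenportMNT1980, arXiv:2602.03626
[crux] CHILD 2 of the GLUED SPLIT of Q = BoundedSiegelZeroQuality (stmt-Parity-25148; REFINES
route-Parity-SiegelSpectrumSplit:stmt-Parity-25148 — lens-2 node «SiegelBandSplit»,
HOME/decomp-parity-lens-2/SiegelBandSplit.lean sha256
5ceeb14908cf96ef5c8b5c9efe6606ef15477975de6a5c312bd1dfa465748240). Piece L «the GENERIC band is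
empty»: there are c > 0 and D₀ such that for every real primitive χ mod D ≥ D₀, L(σ,χ) ≠ 0 whenever
1 − c/log D < σ ≤ 1 − (log D)^{−2025} — the classical region holds DOWN TO the polylog line
(moderate-quality Siegel zeros do not exist; the exponent 2025 = 2024 + 1 absorbs the unknown c₂ of
H). ‖ TAG [crit-1 CLEARED 2026-08-30T02:22:43Z, HOME/STATUS.md l.46]: WEAKER (kernel Q ⟹ L:
`SplitQ.low_of_Q` / lens-2 `lowBandZeroFree_of_boundedQuality`; L ⇏ Q: a world whose only real zeros
have super-polylog quality) and NOT COSTUME today (no polylog zero-free region of ANY exponent is a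
theorem: unconditional ceilings are β₁ ≤ 1 − c/(q^{1/2} log² q) effective [corpus:montgomery2007
p.283 Cor 11.12] and Siegel's q^{−ε} ineffective); leaf IDEA-NEEDED — L carries essentially ALL of
the Landau–Siegel difficulty (the moderate band has no arithmetic leverage: a zero at 1 − 1 -/
@[route_item "route-Parity-SiegelBandSplit", crux]
def LowBandZeroFree : Prop :=
  ∃ c : ℝ, 0 < c ∧ ∃ D₀ : ℕ, ∀ (D : ℕ) [NeZero D] (χ : DirichletCharacter ℂ D), D₀ ≤ D → χ.IsQuadratic → χ.IsPrimitive → ∀ σ : ℝ, 1 - c / Real.log D < σ → σ ≤ 1 - 1 / Real.log D ^ 2025 → χ.LFunction σ ≠ 0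

/-- item stmt-Parity-25906 · crux · rank 3 · open · by planner
why it might fail: Zhang2022LandauSiegel Thm 2 is a claim under adjudication, not refereed; it is false iff real zeros of quality > (log D)^2024/c₂ exist for infinitely many conductors (no unconditional exclusion beyond Siegel's ineffective bound).
sources: Zhang2022LandauSiegel, MontgomeryVaughan2007, DavenportMNT1980
[crux] CHILD 1 of the GLUED SPLIT of the blocker leaf Q = BoundedSiegelZeroQuality
(stmt-Parity-25148; decomp-parity gen 2, REFINES route-Parity-SiegelSpectrumSplit:stmt-Parity-25148
— lens-2 node «SiegelBandSplit», HOME/decomp-parity-lens-2/SiegelBandSplit.lean sha256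
5ceeb14908cf96ef5c8b5c9efe6606ef15477975de6a5c312bd1dfa465748240). Piece H «the SPECIAL band is
empty»: there is an absolute c₂ > 0 such that for every real primitive character χ mod D ≥ 3, L(σ,χ)
≠ 0 for σ > 1 − c₂/(log D)^2024 — word for word Zhang's claimed Theorem 2 (=
`Literature.NumberTheory.LFunctions.Zhang2022.Skeleton.Theorem2` = `ZeroFreeRegion 2024`, Iff.rfl:
writer pkg2 `SplitQ.high_iff_theorem2`). ‖ TAG [crit-1 CLEARED 2026-08-30T02:22:43Z, HOME/STATUS.md
l.46]: WEAKER (kernel Q ⟹ H: `SplitQ.high_of_Q` / lens-2 `highBandZeroFree_of_boundedQuality`; H ⇏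
Q: zeros of quality ≍ (log D)^k, 1 ≪ k < 2023, are H-consistent and make Q false); leaf ATTACKABLE =
exactly what the live Landau–Siegel routes deliver (registered rung F-S3
`Zhang2022.Skeleton.Theorem1` ⟹ H by the tree theorem `theorem2_of_theorem1`; routes
PrimeLevelFamEdge / ZDegreeToeplitzBand close F-S3; any effective L(1,χ) ≫ (log D)^{−B}, B ≤ 2022 ⟹ -/
@[route_item "route-Parity-SiegelBandSplit", crux]
def HighBandZeroFree : Prop :=
  ∃ c₂ : ℝ, 0 < c₂ ∧ ∀ (D : ℕ) [NeZero D] (χ : DirichletCharacter ℂ D), 3 ≤ D → χ.IsQuadratic → χ.IsPrimitive → ∀ σ : ℝ, 1 - c₂ / Real.log D ^ 2024 < σ → χ.LFunction σ ≠ 0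

/-- item stmt-Parity-25149 · crux · rank 4 · open · by planner
why it might fail: as a TARGET it is the parity-even half of GHL with the Siegel obstruction removed: uniform upper constants below 2 are blocked for Type-I sieves (Selberg1949) and even factor 1+o(1) for pairs is open under GRH; it may be as hard as GHL given Q.
sources: Selberg1949, Bombieri1976, GreenTao2010, FriedlanderIwaniec2022
[crux] assuming bounded Siegel-zero quality, the UPPER half of shift-uniform GHL: for all d, t, L, ε
and N ≥ N₀(d,t,L,ε), every non-degenerate system Ψ with ‖Ψ‖_N ≤ L and convex K ⊆ [−N,N]^d has Σ_{n ∈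
K} ∏Λ(ψ_i(n)) − β_∞·∏β_p ≤ εN^d (DECLARED-RESIDUAL of the upper half, conditioned on Q; strictness:
a proof of (this → UpperGHL) is a proof of Q, kernel strict_upper). [deps: BoundedSiegelZeroQuality]
[difficulty: open-problem] ‖ TAG [crit-1 CLEARED 2026-08-30T01:46:27Z, HOME/STATUS.md l.26]:
WEAKER-formal + DECLARED-RESIDUAL(Q) of the UPPER half (strictness certificate strict_upper); leaf
ATTACKABLE rung ladder 4 PROVED (TwinSieveFour.twinSieveUpperBound_four = BC5 witness) → 7/2 →
3.2996 → 2 (EH) + BARRIER(SelbergParity) below 2. BC3 birth skeleton: stub_upperDimOne (Q → upper d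
= 1 half, open) → stub_upperFibration (one-sided fibration d → 1, provable-now) → UQ. Census
HOME/census/COSTUME-CENSUS-v1.md sha256
4afbbbc68c038369818dcc2bcc5990569ac50a4757d8938468c0838377ddd628 row WK7. -/
@[route_item "route-Parity-SiegelBandSplit", crux]
def UpperGivenBoundedSiegel : Prop :=
  (∃ η₀ : ℝ, ∃ q₀ : ℕ, ∀ (q : ℕ) [NeZero q] (χ : DirichletCharacter ℂ q) (η : ℝ), q₀ ≤ q → Literature.Barriers.Parity.IsSiegelZero χ η → η < η₀) → ∀ (d t L : ℕ), 1 ≤ d → 1 ≤ t → ∀ ε : ℝ, 0 < ε → ∃ N₀ : ℕ, ∀ N : ℕ, N₀ ≤ N → ∀ Ψ : Fin t → Literature.NumberTheory.Sieve.AffLinForm d, Literature.NumberTheory.Sieve.IsNondegenerateSystem Ψ → Literature.NumberTheory.Sieve.affLinSize Ψ N ≤ L → ∀ K : Set (Fin d → ℝ), Convex ℝ K → K ⊆ Literature.NumberTheory.Sieve.realBox d N → Literature.NumberTheory.Sieve.vonMangoldtSum Ψ K N - Literature.NumberTheory.Sieve.archFactor Ψ K * Literature.NumberTheory.Sieve.singularProduct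 Ψ ≤ ε * (N : ℝ) ^ d

/-- item stmt-Parity-25150 · crux · rank 5 · open · by planner
why it might fail: as a TARGET it contains the twin prime asymptotic lower bound; every Type-I/II route to positive pair lower bounds is blocked by parity (Selberg1949, Bombieri1976, FordMaynard2024) even given Q; no idea on file produces primes in pairs.
sources: GreenTao2010, Bombieri1976, FordMaynard2024, FriedlanderIwaniec2022
[crux] assuming bounded Siegel-zero quality, the LOWER half of shift-uniform GHL: same quantifier
block, conclusion β_∞·∏β_p − Σ ≤ εN^d (DECLARED-RESIDUAL of the lower half, conditioned on Q;
STRICTLY weaker than the bare lower half: a proof of (this → LowerGHL) proves Landau–Siegel at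
conductors 4 ∣ q, kernel strict_lower via the factor-0 family h = q/2). [deps:
BoundedSiegelZeroQuality] [difficulty: open-problem] ‖ TAG [crit-1 CLEARED 2026-08-30T01:46:27Z,
HOME/STATUS.md l.26; amendment A1 l.24]: WEAKER-formal + DECLARED-RESIDUAL(Q) of the LOWER half
(strictness certificate strict_lower: Landau–Siegel at 4 ∣ q; tribunal residual of this filing);
leaf IDEA-NEEDED + BARRIER(PrimePairParity, FordMaynardPrimeSieves); rung TwinLowerDensity
stmt-Parity-18377 (LIVE route OneSidedAggregateExchangeRate; lens-4 child PPBG ∧ TwinShare). BC3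
birth skeleton: stub_lowerDimOneQ (open) → stub_lowerFibration (provable-now) → LQ. Census
HOME/census/COSTUME-CENSUS-v1.md sha256
4afbbbc68c038369818dcc2bcc5990569ac50a4757d8938468c0838377ddd628 rows WK7, RG0. -/
@[route_item "route-Parity-SiegelBandSplit", crux]
def LowerGivenBoundedSiegel : Prop :=
  (∃ η₀ : ℝ, ∃ q₀ : ℕ, ∀ (q : ℕ) [NeZero q] (χ : DirichletCharacter ℂ q) (η : ℝ), q₀ ≤ q → Literature.Barriers.Parity.IsSiegelZero χ η → η < η₀) → ∀ (d t L : ℕ), 1 ≤ d → 1 ≤ t → ∀ ε : ℝ, 0 < ε → ∃ N₀ : ℕ, ∀ N : ℕ, N₀ ≤ N → ∀ Ψ : Fin t → Literature.NumberTheory.Sieve.AffLinForm d, Literature.NumberTheory.Sieve.IsNondegenerateSystem Ψ → Literature.NumberTheory.Sieve.affLinSize Ψ N ≤ L → ∀ K : Set (Fin d → ℝ), Convex ℝ K → K ⊆ Literature.NumberTheory.Sieve.realBox d N → Literature.NumberTheory.Sieve.archFactor Ψ K * Literature.NumberTheory.Sieve.singularProduct Ψ - Literature.NumberTheory.Sieve.vonMangoldtSum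 Ψ K N ≤ ε * (N : ℝ) ^ d

/-- item stmt-Parity-26321 · assembly · rank 1 · closed · proved by Summit.Parity.GeneralizedHardyLittlewood.Theses.SiegelBandSplit.assembly_proof (prover) · by planner
sources: GreenTao2010, TaoTeravainen2021
[assembly] HighBandZeroFree → LowBandZeroFree → UpperGivenBoundedSiegel → LowerGivenBoundedSiegel →
GeneralizedHardyLittlewood -/
@[route_item "route-Parity-SiegelBandSplit"]
def Assembly : Prop :=
  HighBandZeroFree → LowBandZeroFree → UpperGivenBoundedSiegel → LowerGivenBoundedSiegel → GeneralizedHardyLittlewood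

-- `Assembly` holds: proved by `Summit.Parity.GeneralizedHardyLittlewood.Theses.SiegelBandSplit.assembly_proof` (its module imports this route file, so no `_holds` link can be stated here).

/-! D-0027 §2.1 — DECIDING THEOREM (planner-authored via `route open/edit --closes-file`; by planner-decomp-parity-lens-2-g2-0 2026-08-30T03:09:51Z) — ARCHIVED: route closed (superseded) 2026-08-30T10:33:09Z; kept so importers keep building:
its hypotheses are this route's items and its conclusion the sub-problem Statement (glue_lint), and it elaborates with this file. -/

@[closes "route-Parity-SiegelBandSplit"] theorem closes (hH : HighBandZeroFree) (hL : LowBandZeroFree) (hUQ : UpperGivenBoundedSiegel)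
    (hLQ : LowerGivenBoundedSiegel) : GeneralizedHardyLittlewood := by
  -- Step 1: the two bands exhaust the Siegel zeros — bounded quality at large conductors (Q).
  have hQ : ∃ η₀ : ℝ, ∃ q₀ : ℕ, ∀ (q : ℕ) [NeZero q] (χ : DirichletCharacter ℂ q) (η : ℝ),
      q₀ ≤ q → Literature.Barriers.Parity.IsSiegelZero χ η → η < η₀ := by
    obtain ⟨c₂, hc₂, hZ⟩ := hH
    obtain ⟨c, hc, D₀, hB⟩ := hL
    refine ⟨1 / c + 1, max D₀ (max 3 (Nat.ceil (Real.exp (1 / c₂)))), fun q _ χ η hq hS => ?_⟩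
    by_contra hη
    push Not at hη
    obtain ⟨hprim, hquad, h10, hL0⟩ := hS
    have hqD₀ : D₀ ≤ q := le_of_max_le_left hq
    have hq3 : 3 ≤ q := le_of_max_le_left (le_of_max_le_right hq)
    have hqe : Nat.ceil (Real.exp (1 / c₂)) ≤ q := le_of_max_le_right (le_of_max_le_right hq)
    have hq1 : (1 : ℝ) < q := by exact_mod_cast (show 1 < q by omega)
    have hlog : 0 < Real.log (q : ℝ) := Real.log_pos hq1
    have hlogc : 1 / c₂ ≤ Real.log (q : ℝ) := by
      have h1 : Real.exp (1 / c₂) ≤ q := le_trans (Nat.le_ceil _) (by exact_mod_cast hqe)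
      exact (Real.le_log_iff_exp_le (by linarith)).mpr h1
    have hc₂log : 1 ≤ c₂ * Real.log (q : ℝ) := by
      have h1 := mul_le_mul_of_nonneg_left hlogc hc₂.le
      rwa [mul_one_div_cancel hc₂.ne'] at h1
    have hη0 : 0 < η := by linarith
    have hcη : 1 < c * η := by
      have h1 : 1 / c < η := by linarith
      have h2 := (div_lt_iff₀ hc).1 h1
      linarith [mul_comm η c]
    have hσ : 1 - c / Real.log q < 1 - 1 / (η * Real.log q) := by
      have h3 : 1 / (η * Real.log q) < c / Real.log q := by
        rw [div_lt_div_iff₀ (by positivity) hlog]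
        nlinarith
      linarith
    by_cases hband : 1 - c₂ / Real.log q ^ 2024 < 1 - 1 / (η * Real.log q)
    · exact hZ q χ hq3 hquad hprim _ hband hL0
    · push Not at hband
      refine hB q χ hqD₀ hquad hprim _ hσ ?_ hL0
      have hkey : 1 / Real.log (q : ℝ) ^ 2025 ≤ c₂ / Real.log (q : ℝ) ^ 2024 := by
        rw [div_le_div_iff₀ (by positivity) (by positivity),
          show Real.log (q : ℝ) ^ 2025 = Real.log (q : ℝ) ^ 2024 * Real.log (q : ℝ) from pow_succ _ _]
        nlinarith [pow_pos hlog 2024]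
      linarith
  -- Step 2: Q discharges both parity halves; the two one-sided bounds give the two-sided one.
  intro d t L hd ht ε hε
  obtain ⟨N₁, h₁⟩ := hUQ hQ d t L hd ht ε hε
  obtain ⟨N₂, h₂⟩ := hLQ hQ d t L hd ht ε hε
  refine ⟨max N₁ N₂, fun N hN Ψ hΨ hΨL K hK hKN => abs_sub_le_iff.mpr ⟨?_, ?_⟩⟩
  · exact h₁ N (le_trans (le_max_left _ _) hN) Ψ hΨ hΨL K hK hKN
  · exact h₂ N (le_trans (le_max_right _ _) hN) Ψ hΨ hΨL K hK hKN

end Summit.Parity.GeneralizedHardyLittlewood.Theses.SiegelBandSplit
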